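import Summits.NavierStokesRegularity.FluidComputer.GateBudgetFiringTeeth
import HarnessLib

/-!
# What no tuning can beat, part 22b: THE FIRING TEETH, from the dynamics — under the polynomial
# trigger hypotheses the half-lattice member `2ε = (2k+1)Mρ²` FIRES after its clock has died, and
# every dyadic knob window with `σ_knob M ≤ 4/3` contains one (the knob's response is a COMB:
# duds at `σ_knob M = 1/k`, teeth at `σ_knob M = 2/(2k+1)`)

Cell `pub-fluidc`, blueprint seat bp1 (gen 30); same namespace and conventions as parts 1–21
(`GateBudget*.lean`); the second half of part 22, split off part 22a (`GateBudgetFiringTeeth`: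
the transfer freeze, the drain, the quadrature exit and `knob_lattice_fire` at the level
hypotheses) for the 400-line lint; imports it (and through it part 20 `GateBudgetLatticeMember`,
parts 5, 12, 16, 17, 19). Modes `0 = a` input, `1 = b` clock, `2 = c` catalyst (`u = c/ρ²`),
`3 = d` transfer, `4 = ã` output; `σ_knob = ρ²/ε`. HONEST FRAMING (verbatim): low prior, high
value-of-information experiment on Tao's machine paradigm; NOT a claim that NS blows up.

THE POINT (§66). Part 22a's `knob_lattice_fire` fires the half-lattice member GIVEN the levels of
part 17 (armed entry, catalyst alive, clock radius, dead exit, pre-entry dose) and the numeric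
side conditions `hψ`, `hD`, `hm`, `hfire`. Here every LEVEL is discharged by part 19's
`knob_dynamic_levels` exactly as part 20 did for the dud (`winding_psi_le` is part 20's closed
form of the phase budget for a REAL winding number `κ₀ = ε/(Mρ²) ≤ κ`):
`knob_lattice_member_fires` — under `16 ≤ K`, `48 log K ≤ M ≤ K¹⁰`, `ε² ≤ 1/(6K²⁰)`,
`2ε = (2k+1)Mρ²` and `Δ < 1/16`, with `ψ`, `D` above the closed forms, `ψ²/2 + D ≤ 1` and
`θ ≤ (K/8)((1 - ψ²/2 - D)² - A′ - θ²)`, `A′ = 8(K⁻¹⁰ + 4e^{-M}/M)/M + e^{-M}/M`, the member FIRES: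
`ã(t) ≥ θ` for all `t ≥ T + 1/8`, `T` its own dousing time (`1 ≤ s₀ ≤ 3/2 < T ≤ s₀ + Δ`).
`exists_half_lattice_knob`: every window `[ρhi²/2, ρhi²]` with `3Mρhi² ≤ 4ε` holds a half-lattice
knob with `k + ½ ≤ 2ε/(Mρhi²)`; `knob_window_member_fires`: EVERY DYADIC KNOB WINDOW WITH
`σ_knob M ≤ 4/3` CONTAINS A MEMBER THAT FIRES AFTER ITS CLOCK HAS DIED. With part 20: every such
window contains a dud AND a firing member — neither outcome is robust in the knob at scale
`σ_knob M ~ 1`; the response in `σ_knob` is a comb of pitch `~1/M`.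

HONEST LIMITS. (i) Informative only for `ψ²/2 + D` small (`κ ≲ M/10`, `K²Δ² ≲ 1`): `hψ`, `hD`,
`hm`, `hfire` stay explicit hypotheses, NOT discharged here (at `M = K¹⁰` they hold with
`θ = 3/4` on every window with `200ε/K²⁰ ≤ ρhi² ≤ 4ε/(3K¹⁰)`: part 23 `GateBudgetComb`).
(ii) Windows with winding number `2ε/(Mρhi²) ∈ (1, 3/2)` contain NO half-lattice point: the
hypothesis `3Mρhi² ≤ 4ε` is needed, part 20's duds only need `Mρhi² ≤ 2ε`. (iii) Member-specific
times: the dud of part 20 and the tooth have each ITS OWN `T`; no common-time statement is made,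
and a second pulse of the DUD after `T + 1/8` is still not excluded (the tooth has fired for good:
`ã` is monotone). (iv) Nothing about members off the two lattices, or about Navier–Stokes.
[cite: Tao2016AveragedNS, §5.5 Theorem 5.3, (5.5), (5.6), (b-eq), (c-eq), (tcable)]
-/

noncomputable section

namespace Summit.NavierStokesRegularity.FluidComputer.GateBudget

open Real Set Filter Topology
open Literature.Analysis.FluidPDE.Tao2016AveragedNS

variable {K M ε ρ : ℝ} {X : ℝ → Fin 5 → ℝ} {C : ℝ → ℝ}

/-! ## §66 The half-lattice member fires, from the dynamics; every window holds one -/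

/-- **The phase budget at a real winding number, closed form.** Part 20's `lattice_psi_le` with
the natural winding number `k` replaced by a real one: `ε = κ₀Mρ²` (`κ₀ρ² = ε/M`), `0 ≤ κ₀ ≤ κ`,
`M ≥ 133`, `τ ≤ Δ` give `κ₀ζ + 3/(2K¹⁰) ≤ 6/(MK¹⁰) + 16e^{-M}/M²
+ (κ·π·100/(49M) + 10e^{-M}Δ/(7M))/(1 - 100/(49M)) + 3/(2K¹⁰)` at the levels of part 19
(`arctan x ≤ x`). [cite: Tao2016AveragedNS, §5.5 Theorem 5.3, (b-eq), (c-eq)] -/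
theorem winding_psi_le {K M ε ρ τ Δ κ : ℝ} (κ₀ : ℝ) (hκ0 : 0 ≤ κ₀) (hk : ε = κ₀ * M * ρ ^ 2)
    (hκ : κ₀ ≤ κ) (hε : 0 < ε) (hρ : 0 < ρ) (hM : 133 ≤ M) (hK : 0 < K) (hτ : τ ≤ Δ) :
    κ₀ * (arctan (ρ ^ 2 / K ^ 10 / (ε / 2))
        + arctan ((1 / K ^ 10 + 4 * exp (-M) / M) * ρ ^ 2 / (ε / 4))
        + (π * (ε ^ 2 / (M * (7 / 10 * ε) ^ 2)) + ρ ^ 2 * exp (-M) * τ / (7 / 10 * ε))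
          / (1 - ε ^ 2 / (M * (7 / 10 * ε) ^ 2))) + 3 / (2 * K ^ 10)
      ≤ 6 / (M * K ^ 10) + 16 * exp (-M) / M ^ 2
        + (κ * (π * (100 / (49 * M))) + 10 * exp (-M) * Δ / (7 * M)) / (1 - 100 / (49 * M))
        + 3 / (2 * K ^ 10) := by
  -- `arctan x ≤ x` for `x ≥ 0` (from `x ≤ tan x` on `[0, π/2)`), as a local fact
  have harc : ∀ {x : ℝ}, 0 ≤ x → arctan x ≤ x := fun {x} hx => by
    have h := Real.le_tan (Real.arctan_nonneg.2 hx) (Real.arctan_lt_pi_div_two x)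
    rwa [Real.tan_arctan] at h
  have hM0 : 0 < M := by linarith
  have hK10 : 0 < K ^ 10 := by positivity
  have heM : 0 < exp (-M) := exp_pos _
  -- the winding identity `κ₀ρ² = ε/M` and the critical ratio `q = 100/(49M) < 1`
  have hkρ : κ₀ * ρ ^ 2 = ε / M := by
    rw [eq_div_iff hM0.ne']; rw [hk]; ring
  have hq : ε ^ 2 / (M * (7 / 10 * ε) ^ 2) = 100 / (49 * M) := by
    field_simp; ring
  rw [hq]
  have hq1 : 0 < 1 - 100 / (49 * M) := by
    rw [sub_pos, div_lt_one (by positivity)]; linarith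
  -- the two arctangents
  have h1 : κ₀ * arctan (ρ ^ 2 / K ^ 10 / (ε / 2)) ≤ 2 / (M * K ^ 10) := by
    have hx : 0 ≤ ρ ^ 2 / K ^ 10 / (ε / 2) := by positivity
    calc κ₀ * arctan (ρ ^ 2 / K ^ 10 / (ε / 2))
        ≤ κ₀ * (ρ ^ 2 / K ^ 10 / (ε / 2)) := mul_le_mul_of_nonneg_left (harc hx) hκ0
      _ = 2 * (κ₀ * ρ ^ 2) / (ε * K ^ 10) := by field_simp
      _ = 2 / (M * K ^ 10) := by rw [hkρ]; field_simp
  have h2 : κ₀ * arctan ((1 / K ^ 10 + 4 * exp (-M) / M) * ρ ^ 2 / (ε / 4))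
      ≤ 4 / (M * K ^ 10) + 16 * exp (-M) / M ^ 2 := by
    have hx : 0 ≤ (1 / K ^ 10 + 4 * exp (-M) / M) * ρ ^ 2 / (ε / 4) := by positivity
    calc κ₀ * arctan ((1 / K ^ 10 + 4 * exp (-M) / M) * ρ ^ 2 / (ε / 4))
        ≤ κ₀ * ((1 / K ^ 10 + 4 * exp (-M) / M) * ρ ^ 2 / (ε / 4)) :=
          mul_le_mul_of_nonneg_left (harc hx) hκ0
      _ = 4 * (1 / K ^ 10 + 4 * exp (-M) / M) * (κ₀ * ρ ^ 2) / ε := by field_simp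
      _ = 4 / (M * K ^ 10) + 16 * exp (-M) / M ^ 2 := by rw [hkρ]; field_simp; ring
  -- the drift term of the phase budget: `κ₀` cancels
  have h3 : κ₀ * (ρ ^ 2 * exp (-M) * τ / (7 / 10 * ε)) ≤ 10 * exp (-M) * Δ / (7 * M) := by
    calc κ₀ * (ρ ^ 2 * exp (-M) * τ / (7 / 10 * ε))
        = 10 * exp (-M) * τ * (κ₀ * ρ ^ 2) / (7 * ε) := by field_simp
      _ = 10 * exp (-M) * τ / (7 * M) := by rw [hkρ]; field_simp
      _ ≤ 10 * exp (-M) * Δ / (7 * M) := by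
          apply div_le_div_of_nonneg_right _ (by positivity)
          exact mul_le_mul_of_nonneg_left hτ (by positivity)
  -- the critical winding, `κ₀ ≤ κ`
  have h4 : κ₀ * (π * (100 / (49 * M))) ≤ κ * (π * (100 / (49 * M))) :=
    mul_le_mul_of_nonneg_right hκ (by positivity)
  have hsplit : κ₀ * (arctan (ρ ^ 2 / K ^ 10 / (ε / 2))
        + arctan ((1 / K ^ 10 + 4 * exp (-M) / M) * ρ ^ 2 / (ε / 4))
        + (π * (100 / (49 * M)) + ρ ^ 2 * exp (-M) * τ / (7 / 10 * ε))
          / (1 - 100 / (49 * M)))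
      = κ₀ * arctan (ρ ^ 2 / K ^ 10 / (ε / 2))
        + κ₀ * arctan ((1 / K ^ 10 + 4 * exp (-M) / M) * ρ ^ 2 / (ε / 4))
        + (κ₀ * (π * (100 / (49 * M))) + κ₀ * (ρ ^ 2 * exp (-M) * τ / (7 / 10 * ε)))
          / (1 - 100 / (49 * M)) := by ring
  rw [hsplit]
  have h5 : (κ₀ * (π * (100 / (49 * M))) + κ₀ * (ρ ^ 2 * exp (-M) * τ / (7 / 10 * ε)))
        / (1 - 100 / (49 * M))
      ≤ (κ * (π * (100 / (49 * M))) + 10 * exp (-M) * Δ / (7 * M)) / (1 - 100 / (49 * M)) :=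
    div_le_div_of_nonneg_right (by linarith) hq1.le
  have h6 : (6 : ℝ) / (M * K ^ 10) = 2 / (M * K ^ 10) + 4 / (M * K ^ 10) := by ring
  linarith [h6]

/-- **THE HALF-LATTICE MEMBER FIRES — from the dynamics.** Along an exact trajectory of
`rotorCircuit K M ε ρ` from (5.6) ON THE HALF LATTICE `2ε = (2k+1)Mρ²` (`k ≥ 0`; `ρ² ≤ ε` and
`Mρ⁴ ≤ ε²` follow), under the polynomial trigger hypotheses `16 ≤ K`, `48 log K ≤ M ≤ K¹⁰`,
`ε² ≤ 1/(6K²⁰)` and with `(8/M)log(25εK¹⁰/(8ρ²)) + 200/(169M - 400) ≤ Δ < 1/16`: there are times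
`1 ≤ s₀ ≤ 3/2 < T`, `T - s₀ ≤ Δ` (the member's OWN critical and dousing times, part 19) such that
`|a(T)| ≤ ψ + D`, `|d(T)| ≥ 1 - ψ²/2 - D`, and `ã(t) ≥ θ` FOR ALL `t ≥ T + 1/8`, for ANY
`ψ ≥ 6/(MK¹⁰) + 16e^{-M}/M² + (κ·π·100/(49M) + 10e^{-M}Δ/(7M))/(1 - 100/(49M)) + 3/(2K¹⁰)`
(`κ ≥ k + ½`), `D ≥ 6(ε + Pe^{-M} + 3/K⁹) + 2(ε + Pe^{-M} + 3/K⁹ + K²Δ)Δ` (`P ≥ ρ²`) with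
`ψ²/2 + D ≤ 1`, and any `0 ≤ θ ≤ (K/8)((1 - ψ²/2 - D)² - A′ - θ²)`,
`A′ = 8(K⁻¹⁰ + 4e^{-M}/M)/M + e^{-M}/M` — §65 with every level discharged by part 19's
`knob_dynamic_levels` (`β = ε/4`, `λ₀ = K⁻¹⁰ + 4e^{-M}/M`, `ϱ = 7ε/10`, …) and the closed forms.
Informative when `ψ²/2 + D` is small (HONEST LIMITS (i)); nothing about NS.
[cite: Tao2016AveragedNS, §5.5 Theorem 5.3, (5.5), (5.6), (b-eq), (c-eq), (tcable)] -/
theorem knob_lattice_member_fires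
    (hX : ∀ t, HasDerivAt X (RotorKnob.rotorCircuit K M ε ρ (X t)) t)
    (h0 : X 0 = delayInit) (hε : 0 < ε) (hρ : 0 < ρ) (hM : 0 < M) (hMK : M ≤ K ^ 10)
    (hK : 16 ≤ K) (hML : 48 * Real.log K ≤ M) (hεK : ε ^ 2 ≤ 1 / (6 * K ^ 20))
    (hC : ∀ t, HasDerivAt C (X t 2) t) (k : ℕ) (hk : 2 * ε = (2 * k + 1) * M * ρ ^ 2)
    {κ P Δ ψ D θ : ℝ} (hκ : (k : ℝ) + 1 / 2 ≤ κ) (hP : ρ ^ 2 ≤ P)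
    (hΔ : 8 * log (25 * ε * K ^ 10 / (8 * ρ ^ 2)) / M + 200 / (169 * M - 400) ≤ Δ)
    (hH : Δ < 1 / 16)
    (hψ : 6 / (M * K ^ 10) + 16 * exp (-M) / M ^ 2
        + (κ * (π * (100 / (49 * M))) + 10 * exp (-M) * Δ / (7 * M)) / (1 - 100 / (49 * M))
        + 3 / (2 * K ^ 10) ≤ ψ)
    (hD : 6 * (ε + P * exp (-M) + 3 / K ^ 9)
        + 2 * (ε + P * exp (-M) + 3 / K ^ 9 + K ^ 2 * Δ) * Δ ≤ D)
    (hm : 0 ≤ 1 - ψ ^ 2 / 2 - D) (hθ : 0 ≤ θ)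
    (hfire : θ ≤ K / 8 * ((1 - ψ ^ 2 / 2 - D) ^ 2
        - (8 * (1 / K ^ 10 + 4 * exp (-M) / M) / M + exp (-M) / M) - θ ^ 2)) :
    ∃ s₀ T : ℝ, 1 ≤ s₀ ∧ s₀ ≤ 3 / 2 ∧ s₀ < T ∧ T - s₀ ≤ Δ ∧
      |X T 0| ≤ ψ + D ∧ 1 - ψ ^ 2 / 2 - D ≤ |X T 3| ∧ ∀ t, T + 1 / 8 ≤ t → θ ≤ X t 4 := by
  have hK0 : 0 < K := by linarith
  have hK1 : 1 ≤ K := by linarith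
  have hk0 : (0 : ℝ) ≤ k := Nat.cast_nonneg k
  have hε2 : 0 < ε ^ 2 := by positivity
  have hM133 : 133 ≤ M := by
    have h16 : log 16 = 4 * log 2 := by
      rw [show (16 : ℝ) = 2 ^ 4 by norm_num, Real.log_pow]; norm_num
    have hlogK : log 16 ≤ log K := log_le_log (by norm_num) hK
    linarith [Real.log_two_gt_d9]
  -- consequences of the half-lattice relation `2ε = (2k+1)Mρ²`, `M ≥ 133`
  have hk' : ε = (k + 1 / 2) * M * ρ ^ 2 := by linarith
  have hMρ2 : M * ρ ^ 2 ≤ 2 * ε := by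
    have : 0 ≤ (k : ℝ) * M * ρ ^ 2 := by positivity
    linarith
  have hρε : ρ ^ 2 ≤ ε := by
    have : 133 * ρ ^ 2 ≤ M * ρ ^ 2 := mul_le_mul_of_nonneg_right hM133 (sq_nonneg ρ)
    linarith
  have hMρ : M * ρ ^ 4 ≤ ε ^ 2 := by
    have h1 : (M * ρ ^ 2) ^ 2 ≤ (2 * ε) ^ 2 := pow_le_pow_left₀ (by positivity) hMρ2 2
    have h2 : M * ρ ^ 4 * M = (M * ρ ^ 2) ^ 2 := by ring
    have h3 : M * ρ ^ 4 * 4 ≤ M * ρ ^ 4 * M :=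
      mul_le_mul_of_nonneg_left (by linarith) (by positivity)
    nlinarith
  have hε1 : ε ≤ 1 := by
    have hK20 : (1700 : ℝ) ≤ K ^ 20 :=
      le_trans (by norm_num) (pow_le_pow_left₀ (by norm_num) hK 20)
    have h1 : ε ^ 2 ≤ 1 := by
      refine hεK.trans ?_
      rw [div_le_one (by positivity)]; linarith
    nlinarith
  -- part 19: the levels at the member's critical time `s₀` and dousing time `T`
  obtain ⟨s₀, T, hs1, hs32, hsT, hTΔ, hcpos, harm, hbs, hcs, hbT, hcT, hΦ, ha₀, haT, -, -⟩ :=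
    knob_dynamic_levels hX h0 hε hρ hρε hM hMK hK hML hεK hMρ hC (lt_of_le_of_lt hΔ hH)
  have hTΔ' : T - s₀ ≤ Δ := hTΔ.trans hΔ
  have hs0 : 0 ≤ s₀ := by linarith
  -- the critical ratio is subunit on the window radius `ϱ = 7ε/10`
  have hq : ε ^ 2 < M * (7 / 10 * ε) ^ 2 := by
    have hMε : 133 * ε ^ 2 ≤ M * ε ^ 2 := mul_le_mul_of_nonneg_right hM133 hε2.le
    have h49 : M * (7 / 10 * ε) ^ 2 = 49 / 100 * (M * ε ^ 2) := by ring
    rw [h49]; linarith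
  -- the self-timed window `β/(2ε) = 1/8` and the transfer afterglow `2ελ₀/(Mβ) = 8λ₀/M`
  have h8 : ε / 4 / (2 * ε) = 1 / 8 := by
    field_simp; ring
  have hA : 2 * ε * (1 / K ^ 10 + 4 * exp (-M) / M) / (M * (ε / 4))
      = 8 * (1 / K ^ 10 + 4 * exp (-M) / M) / M := by
    field_simp; ring
  have hfire' : θ ≤ K * ((1 - ψ ^ 2 / 2 - D) ^ 2
      - (2 * ε * (1 / K ^ 10 + 4 * exp (-M) / M) / (M * (ε / 4)) + exp (-M) / M) - θ ^ 2)
        * (ε / 4 / (2 * ε)) := by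
    rw [hA, h8]; linarith
  -- §65 with the levels of part 19 and the closed forms
  obtain ⟨ha, hd, hfired⟩ := knob_lattice_fire hX h0 hε hρ hM hK0.le hC k hk
    (ϱ := 7 / 10 * ε) (β := ε / 4) (b₁ := ε / 2) (γ₁ := ρ ^ 2 / K ^ 10)
    (lam₀ := 1 / K ^ 10 + 4 * exp (-M) / M) (φ₀ := 3 / (2 * K ^ 10)) (ψ := ψ) (D := D)
    (θ := θ) hs0 hsT.le (by positivity) hq hcpos harm (by positivity) hbs hcs.le (by positivity)
    hbT hcT hΦ
    ((winding_psi_le ((k : ℝ) + 1 / 2) (by positivity) hk' hκ hε hρ hM133 hK0 hTΔ').trans hψ)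
    ((lattice_drift_le hK1 hε.le hP hs0 hs32 (by linarith) hTΔ' ha₀ haT).trans hD) hm hθ hfire'
  rw [h8] at hfired
  exact ⟨s₀, T, hs1, hs32, hsT, hTΔ', ha, hd, hfired⟩

/-- **EVERY DYADIC WINDOW WITH `σ_knob M ≤ 4/3` HOLDS A HALF-LATTICE KNOB.** `0 < ε`, `0 < M`,
`0 < ρhi`, `3Mρhi² ≤ 4ε` (winding number `x = 2ε/(Mρhi²) ≥ 3/2`) ⇒ some `k ∈ ℕ` with
`k + ½ ≤ 2ε/(Mρhi²)` has `ρhi²/2 ≤ 2ε/((2k+1)M) ≤ ρhi²` (`k = ⌈(x-1)/2⌉`: `x ≤ 2k+1 ≤ 2x`). For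
`x ∈ (1, 3/2)` the window holds no half-lattice point (HONEST LIMITS (ii)). [folklore] -/
theorem exists_half_lattice_knob (hε : 0 < ε) (hM : 0 < M) {ρhi : ℝ} (hρhi : 0 < ρhi)
    (hwin : 3 * (M * ρhi ^ 2) ≤ 4 * ε) :
    ∃ k : ℕ, (k : ℝ) + 1 / 2 ≤ 2 * ε / (M * ρhi ^ 2) ∧
      ρhi ^ 2 / 2 ≤ 2 * ε / ((2 * k + 1) * M) ∧ 2 * ε / ((2 * k + 1) * M) ≤ ρhi ^ 2 := by
  have hden : 0 < M * ρhi ^ 2 := by positivity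
  set x := 2 * ε / (M * ρhi ^ 2) with hx
  have hx32 : 3 / 2 ≤ x := by
    rw [hx, le_div_iff₀ hden]; linarith
  have hxM : x * (M * ρhi ^ 2) = 2 * ε := by
    rw [hx]; field_simp
  have hy0 : 0 ≤ (x - 1) / 2 := by linarith
  -- `n = 2k + 1` with `x ≤ n ≤ 2x`
  have hlo : x ≤ 2 * (⌈(x - 1) / 2⌉₊ : ℝ) + 1 := by
    have := Nat.le_ceil ((x - 1) / 2)
    linarith
  have hhi : 2 * (⌈(x - 1) / 2⌉₊ : ℝ) + 1 ≤ 2 * x := by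
    by_cases h2 : 2 ≤ x
    · have := Nat.ceil_lt_add_one hy0
      linarith
    · have hle : ⌈(x - 1) / 2⌉₊ ≤ 1 := Nat.ceil_le.2 (by push_cast; linarith)
      have : (⌈(x - 1) / 2⌉₊ : ℝ) ≤ 1 := by exact_mod_cast hle
      linarith
  have hn0 : (0 : ℝ) < 2 * ⌈(x - 1) / 2⌉₊ + 1 := by positivity
  refine ⟨⌈(x - 1) / 2⌉₊, by linarith, ?_, ?_⟩
  · rw [div_le_div_iff₀ (by norm_num) (by positivity)]
    have h := mul_le_mul_of_nonneg_right hhi hden.le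
    nlinarith [hxM]
  · rw [div_le_iff₀ (by positivity)]
    have h := mul_le_mul_of_nonneg_right hlo hden.le
    nlinarith [hxM]

/-- **EVERY DYADIC KNOB WINDOW WITH `σ_knob M ≤ 4/3` CONTAINS A MEMBER THAT FIRES — from the
dynamics.** Let `X r` be, for every knob value `r`, an exact trajectory of `rotorCircuit K M ε r`
from (5.6) and `C r` a primitive of its catalyst; assume `16 ≤ K`, `48 log K ≤ M ≤ K¹⁰`,
`ε² ≤ 1/(6K²⁰)`. For every window `[ρhi²/2, ρhi²]` with `3Mρhi² ≤ 4ε` and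
`(8/M)log(25εK¹⁰/(4ρhi²)) + 200/(169M - 400) ≤ Δ < 1/16` there is a member `r`,
`ρhi²/2 ≤ r² ≤ ρhi²` (the half-lattice point `r² = 2ε/((2k+1)M)` of `exists_half_lattice_knob`),
with its own times `1 ≤ s₀ ≤ 3/2 < T ≤ s₀ + Δ`, which leaves its pulse in transfer phase
(`|a(T)| ≤ ψ + D`, `|d(T)| ≥ 1 - ψ²/2 - D`) and FIRES: `ã(t) ≥ θ` for all `t ≥ T + 1/8` — for any
`ψ ≥ 6/(MK¹⁰) + 16e^{-M}/M² + ((2ε/(Mρhi²))·π·100/(49M) + 10e^{-M}Δ/(7M))/(1 - 100/(49M))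
+ 3/(2K¹⁰)`, `D ≥ 6(ε + ρhi²e^{-M} + 3/K⁹) + 2(ε + ρhi²e^{-M} + 3/K⁹ + K²Δ)Δ`, `ψ²/2 + D ≤ 1`,
`0 ≤ θ ≤ (K/8)((1 - ψ²/2 - D)² - 8(K⁻¹⁰ + 4e^{-M}/M)/M - e^{-M}/M - θ²)`. With part 20's
`knob_window_member_dud` (same hypotheses, `Mρhi² ≤ 2ε`): every such window contains a DUD and a
TOOTH — THE COMB; neither firing nor not-firing is robust in the knob at scale `σ_knob M ~ 1`.
Informative under HONEST LIMITS (i)–(iv); nothing about NS.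
[cite: Tao2016AveragedNS, §5.5 Theorem 5.3, (5.5), (5.6), (b-eq), (c-eq), (tcable)] -/
theorem knob_window_member_fires {X : ℝ → ℝ → Fin 5 → ℝ} {C : ℝ → ℝ → ℝ}
    (hX : ∀ r t, HasDerivAt (X r) (RotorKnob.rotorCircuit K M ε r (X r t)) t)
    (h0 : ∀ r, X r 0 = delayInit) (hC : ∀ r t, HasDerivAt (C r) (X r t 2) t)
    (hε : 0 < ε) (hM : 0 < M) (hMK : M ≤ K ^ 10) (hK : 16 ≤ K) (hML : 48 * Real.log K ≤ M)
    (hεK : ε ^ 2 ≤ 1 / (6 * K ^ 20)) {ρhi Δ ψ D θ : ℝ} (hρhi : 0 < ρhi)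
    (hwin : 3 * (M * ρhi ^ 2) ≤ 4 * ε)
    (hΔ : 8 * log (25 * ε * K ^ 10 / (4 * ρhi ^ 2)) / M + 200 / (169 * M - 400) ≤ Δ)
    (hH : Δ < 1 / 16)
    (hψ : 6 / (M * K ^ 10) + 16 * exp (-M) / M ^ 2
        + (2 * ε / (M * ρhi ^ 2) * (π * (100 / (49 * M))) + 10 * exp (-M) * Δ / (7 * M))
          / (1 - 100 / (49 * M)) + 3 / (2 * K ^ 10) ≤ ψ)
    (hD : 6 * (ε + ρhi ^ 2 * exp (-M) + 3 / K ^ 9)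
        + 2 * (ε + ρhi ^ 2 * exp (-M) + 3 / K ^ 9 + K ^ 2 * Δ) * Δ ≤ D)
    (hm : 0 ≤ 1 - ψ ^ 2 / 2 - D) (hθ : 0 ≤ θ)
    (hfire : θ ≤ K / 8 * ((1 - ψ ^ 2 / 2 - D) ^ 2
        - (8 * (1 / K ^ 10 + 4 * exp (-M) / M) / M + exp (-M) / M) - θ ^ 2)) :
    ∃ r : ℝ, 0 < r ∧ ρhi ^ 2 / 2 ≤ r ^ 2 ∧ r ^ 2 ≤ ρhi ^ 2 ∧
      ∃ s₀ T : ℝ, 1 ≤ s₀ ∧ s₀ ≤ 3 / 2 ∧ s₀ < T ∧ T - s₀ ≤ Δ ∧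
        |X r T 0| ≤ ψ + D ∧ 1 - ψ ^ 2 / 2 - D ≤ |X r T 3| ∧
          ∀ t, T + 1 / 8 ≤ t → θ ≤ X r t 4 := by
  obtain ⟨k, hkκ, hlo, hhi⟩ := exists_half_lattice_knob hε hM hρhi hwin
  have hn0 : (0 : ℝ) < (2 * k + 1) * M := by positivity
  -- the half-lattice member `r² = 2ε/((2k+1)M)` of the window
  obtain ⟨r, hr0, hr2⟩ : ∃ r : ℝ, 0 < r ∧ r ^ 2 = 2 * ε / ((2 * k + 1) * M) :=
    ⟨Real.sqrt (2 * ε / ((2 * k + 1) * M)), Real.sqrt_pos.2 (by positivity),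
      Real.sq_sqrt (by positivity)⟩
  have hk : 2 * ε = (2 * k + 1) * M * r ^ 2 := by
    rw [hr2]; field_simp
  refine ⟨r, hr0, by rw [hr2]; exact hlo, by rw [hr2]; exact hhi, ?_⟩
  -- the member's pulse window is shorter than the window's bound: `8r² ≥ 4ρhi²`
  have hΔr : 8 * log (25 * ε * K ^ 10 / (8 * r ^ 2)) / M + 200 / (169 * M - 400) ≤ Δ := by
    refine le_trans ?_ hΔ
    have hK0 : 0 < K := by linarith
    have hlog : log (25 * ε * K ^ 10 / (8 * r ^ 2)) ≤ log (25 * ε * K ^ 10 / (4 * ρhi ^ 2)) := by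
      apply Real.log_le_log (by positivity)
      apply div_le_div_of_nonneg_left (by positivity) (by positivity)
      rw [hr2]; linarith [hlo]
    have h8 := mul_le_mul_of_nonneg_left hlog (by norm_num : (0 : ℝ) ≤ 8)
    have := div_le_div_of_nonneg_right h8 hM.le
    linarith
  exact knob_lattice_member_fires (hX r) (h0 r) hε hr0 hM hMK hK hML hεK (hC r) k hk hkκ
    (by rw [hr2]; exact hhi) hΔr hH hψ hD hm hθ hfire

end Summit.NavierStokesRegularity.FluidComputer.GateBudget
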